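import Summits.QuantumFields.YangMills.Theorems.BalabanUVNodesK0VariationalThm1OuterRange
import Literature.MathematicalPhysics.QuantumFieldTheory.Balaban1983to89.T3DescentFibreTower
import Literature.MathematicalPhysics.QuantumFieldTheory.Balaban1983to89.T4ReflectionConeSharp

/-!
# K0⁗ ROW P11 — the impulse response of Bałaban's (0.4) averaging to one twisted bond, part A: WALK BOOKKEEPING AND «Ū = 1» OFF THE CROSSED INTERFACE

Cell `pub-ymgap`, seat `pub-ymgap-dag-n21-c` g7 (R134 (a) N21 NE7c s1; K0⁗ ROW P11 negative side; INBOX INTENT-2 of 2026-08-27 ≈07:40Z; dag-n07-e g7 l.17651 «NO STOP —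
19b uses ONLY the crude global bound … your sharp `dist1_avgFun_singleBond_le` is NEW and needed»).  Filed `--kind proof --supports stmt-QuantumFields-20289 --as helper`.
[15] = [Balaban1985Variational]; [I] = [Balaban1987RG1]; [III] = [Balaban1988Convergent]; [B7] = [Balaban1985Averaging].

THE SERIES (four modules, one namespace `…Theorems.K0AveragedSingleBondFloor`): (A) `…K0SingleBondWalks` — walk bookkeeping and «Ū = 1 by avoidance ∕ by locality»;
(B) `…K0SingleBondStarLoops` — the loop variables of [I] (0.4) at the one coarse bond `c⋆` the twisted fine bond crosses, and the printed `exp[mean log]` of a two-valued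
family; (C) `…K0SingleBondResponse` — THE IMPULSE RESPONSE of Bałaban's (0.4) averaging of record (`avOfRecord = blockAvg expMeanLogSU`) to ONE twisted fine bond:
`|Ū(c⋆) − 1| ≤ exp(−log(1−t)∕L^{d−1}) − 1 ≤ 4t∕L³`, `Ū(c) = 1` for every other coarse bond; (D) `…K0AveragedSingleBondFloor` — ★★ THE FLOOR OF RECORD for node00-def-P11's
FILE 8 v1.3 fact: `VariationalThm1RegSepPrinted F N B₃ a₀ a₁ → 2L² ≤ B₃` (every `N ≥ 2`, `a₀, a₁ > 0`), unconditionally (existence by dag-n07-e 19a's small-action boundary avoidance).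
HONEST FRAMING: kernel bookkeeping about the TREE's own averaging and one certificate about a TREE-typed fact; nothing of Bałaban asserted or refuted (print: `B₃ = B₃(d, L)`;
node00-def-K0a displays `2L² ≤ B₃`); K0⁗ neither discharged nor refuted; counts unmoved; no `def`, no `sorry`, no `instance`.

THIS MODULE (A).  For the single-bond configuration `U₁ = (g on ⟨x′, μ₀⟩, 1 elsewhere)` (dag-n07-e 19a's datum): §1 (targets of steps are prefix ends: the tree's
`T4ReflectionConeSharp.exists_tgt_eq_walkEnd_take`, by name) a walk that never VISITS `x′ + e_{μ₀}` (resp. `x′`) has `U₁`-holonomy `1`; the straight segment of `L`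
steps through the bond reads it exactly once (`holAt_single_segment`, value `g`).  §2 the (0.4) loop of [I] p.252–253 at a coarse bond `c` stays in the coordinate box
`emb c₋ + [−h, [c.dir = κ]·L + h]` (tree `netDisp_take_loopWord`), so if one coordinate of that box misses the bond's far end, every loop variable and the straight
transporter are `1` and `Ū(c) = 1` for every small-loop average with `E(1,…,1) = 1` (`avgFun_single_eq_one_of_coord`); and `Ū(c) = 1` by `Averaging.local_dep`
when the bond issues from neither block of `c` (`avgFun_single_eq_one_of_blockOf_ne`).
DEPENDENCES (by name): `BlockAveraging.(loopWord, loopHol, Small, corr, avgFun, off, off_bounds, netDisp_take_loopWord, avgFun_local, axialAvg_eq_holAt_walk)`,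
`T4Continuum.(walk, walkEnd, holAt, walkEnd_apply)`, `T4ReflectionCone.(holAt_congr, netDisp_replicate)`, `T3DescentFibreTower.(holAt_one, avgFun_one)`, `Site.shift_unshift`,
`Site.shift_apply`, `exists_src_eq_walkEnd_take`.
-/

noncomputable section

open scoped Matrix.Norms.L2Operator

namespace Summit.QuantumFields.YangMills.Theorems.K0AveragedSingleBondFloor

open Literature.MathematicalPhysics.QuantumFieldTheory.Balaban1983to89
open Literature.MathematicalPhysics.QuantumFieldTheory.Balaban1983to89.Node00
open Literature.MathematicalPhysics.QuantumFieldTheory.Balaban1983to89.T4Continuum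
open B15DeterminingSets BlockAveraging
open Literature.MathematicalPhysics.QuantumFieldTheory.Balaban1983to89.T3DescentFibreTower (holAt_one axialAvg_one avgFun_one
  expMeanLogSU_E_one loopHol_one small_one)
/-! ## §1  Walk bookkeeping: targets of steps; holonomies of the single-bond configuration along walks avoiding an endpoint; the straight segment -/
section Walks

variable {P : Params} {j : ℕ}

variable {G : Type*} [GaugeGroup G]

/-- **A walk that never VISITS the target `x′ + e_{μ₀}` of the twisted bond does not read it**: the single-bond configuration (value `g` on
`⟨x′, μ₀⟩`, `1` elsewhere — dag-n07-e 19a's datum) has holonomy `1` along it (a step along `⟨x′, μ₀⟩` in either orientation makes `x′ + e_{μ₀}` a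
position of the walk). [folklore] -/
theorem holAt_single_eq_one_of_ne_tgt (x' : Site P j) (μ0 : Fin P.d) (g : G) (x : Site P j) (w : List (Letter P.d))
    (h : ∀ k, walkEnd x (w.take k) ≠ x'.shift μ0) :
    holAt (fun b : PBond P j => if b.src = x' ∧ b.dir = μ0 then g else 1) (walk x w) = 1 := by
  rw [T4ReflectionCone.holAt_congr (V' := (1 : GaugeField P j G)) ?_]
  · exact holAt_one _
  · intro s hs
    show (if s.bond.src = x' ∧ s.bond.dir = μ0 then g else 1) = (1 : GaugeField P j G) s.bond
    rw [if_neg]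
    · rfl
    · rintro ⟨h1, h2⟩
      obtain ⟨k, hk⟩ := T4ReflectionConeSharp.exists_tgt_eq_walkEnd_take x w s hs
      apply h k
      rw [← hk]
      show s.bond.src.shift s.bond.dir = x'.shift μ0
      rw [h1, h2]

/-- **A walk that never VISITS the source `x′` of the twisted bond does not read it** either. [folklore] -/
theorem holAt_single_eq_one_of_ne_src (x' : Site P j) (μ0 : Fin P.d) (g : G) (x : Site P j) (w : List (Letter P.d))
    (h : ∀ k, walkEnd x (w.take k) ≠ x') :
    holAt (fun b : PBond P j => if b.src = x' ∧ b.dir = μ0 then g else 1) (walk x w) = 1 := by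
  rw [T4ReflectionCone.holAt_congr (V' := (1 : GaugeField P j G)) ?_]
  · exact holAt_one _
  · intro s hs
    show (if s.bond.src = x' ∧ s.bond.dir = μ0 then g else 1) = (1 : GaugeField P j G) s.bond
    rw [if_neg]
    · rfl
    · rintro ⟨h1, -⟩
      obtain ⟨k, hk⟩ := exists_src_eq_walkEnd_take x w s hs
      exact h k (by rw [← hk, h1])

/-- Small nonzero integers are nonzero modulo the period. [folklore] -/
theorem intCast_ne_zero_of_natAbs_lt {n : ℕ} {c : ℤ} (h0 : c ≠ 0) (hc : c.natAbs < n) : ((c : ℤ) : ZMod n) ≠ 0 := by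
  intro h
  rw [ZMod.intCast_zmod_eq_zero_iff_dvd] at h
  exact h0 (Int.eq_zero_of_dvd_of_natAbs_lt_natAbs h (by simpa using hc))

/-- Prefix ends of a straight run of `+e_μ` letters, coordinatewise. [folklore] -/
theorem walkEnd_take_replicate_apply (x : Site P j) (μ : Fin P.d) (t k : ℕ) (ν : Fin P.d) :
    walkEnd x ((List.replicate t (μ, true)).take k) ν = x ν + (if μ = ν then ((min k t : ℕ) : ZMod (P.sitesPerDir j)) else 0) := by
  rw [walkEnd_apply, List.take_replicate, T4ReflectionCone.netDisp_replicate]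
  generalize min k t = m
  by_cases h : μ = ν
  · simp [h]
  · simp [h]

/-- **THE STRAIGHT SEGMENT THROUGH THE TWISTED BOND READS IT EXACTLY ONCE**: the walk of `L` steps `+e_{μ₀}` started `a ≤ L − 1` steps before `x′` on its
axis (`z + a·e_{μ₀} = x′`) has holonomy `g` in the single-bond configuration (torus longer than `L` in lattice units, so the segment does not wrap). [folklore] -/
theorem holAt_single_segment (hper : P.L < P.sitesPerDir j) (x' : Site P j) (μ0 : Fin P.d) (g : G) {a : ℕ} (ha : a < P.L) (z : Site P j)
    (hz0 : z μ0 + (a : ZMod (P.sitesPerDir j)) = x' μ0) (hzκ : ∀ κ, κ ≠ μ0 → z κ = x' κ) :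
    holAt (fun b : PBond P j => if b.src = x' ∧ b.dir = μ0 then g else 1) (walk z (List.replicate P.L (μ0, true))) = g := by
  set U : GaugeField P j G := fun b => if b.src = x' ∧ b.dir = μ0 then g else 1 with hU
  have hsplit : List.replicate P.L (μ0, true) = List.replicate a (μ0, true) ++ ((μ0, true) :: List.replicate (P.L - 1 - a) (μ0, true)) := by
    rw [← List.replicate_succ, ← List.replicate_add]
    congr 1
    omega
  -- the position after `a` steps is `x′`
  have hza : walkEnd z (List.replicate a (μ0, true)) = x' := by
    funext ν
    have := walkEnd_take_replicate_apply z μ0 a a ν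
    rw [List.take_of_length_le (by rw [List.length_replicate]), min_self] at this
    rw [this]
    by_cases hν : μ0 = ν
    · subst hν; rw [if_pos rfl, hz0]
    · rw [if_neg hν, add_zero, hzκ ν (Ne.symm hν)]
  rw [hsplit, walk_append, holAt_append, hza]
  -- first factor: never reaches `x′ + e_{μ₀}`
  have h1 : holAt U (walk z (List.replicate a (μ0, true))) = 1 := by
    refine holAt_single_eq_one_of_ne_tgt x' μ0 g z _ (fun k heq => ?_)
    have hc := congrFun heq μ0
    rw [walkEnd_take_replicate_apply, if_pos rfl, Site.shift_apply, if_pos rfl, ← hz0] at hc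
    have hma : min k a ≤ a := Nat.min_le_right k a
    generalize min k a = m at hc hma
    -- `z μ0 + m = z μ0 + a + 1`
    have hc' : (((m : ℤ) - a - 1 : ℤ) : ZMod (P.sitesPerDir j)) = 0 := by
      have := sub_eq_zero.mpr hc
      push_cast at this ⊢
      linear_combination this
    have hne : ((m : ℤ) - a - 1 : ℤ) ≠ 0 := by omega
    have hlt : (((m : ℤ) - a - 1 : ℤ)).natAbs < P.sitesPerDir j := by omega
    exact intCast_ne_zero_of_natAbs_lt hne hlt hc'
  -- the step at `x′` reads `g`; the rest never returns to `x′`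
  have h3 : holAt U (walk (x'.shift μ0) (List.replicate (P.L - 1 - a) (μ0, true))) = 1 := by
    refine holAt_single_eq_one_of_ne_src x' μ0 g _ _ (fun k heq => ?_)
    have hc := congrFun heq μ0
    rw [walkEnd_take_replicate_apply, if_pos rfl, Site.shift_apply, if_pos rfl] at hc
    have hma : min k (P.L - 1 - a) ≤ P.L - 1 - a := Nat.min_le_right k _
    generalize min k (P.L - 1 - a) = m at hc hma
    have hc' : (((m : ℤ) + 1 : ℤ) : ZMod (P.sitesPerDir j)) = 0 := by
      have := sub_eq_zero.mpr hc
      push_cast at this ⊢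
      linear_combination this
    have hne : ((m : ℤ) + 1 : ℤ) ≠ 0 := by omega
    have hlt : (((m : ℤ) + 1 : ℤ)).natAbs < P.sitesPerDir j := by omega
    exact intCast_ne_zero_of_natAbs_lt hne hlt hc'
  rw [h1, one_mul]
  show holAt U (⟨⟨x', μ0⟩, true⟩ :: walk (x'.shift μ0) (List.replicate (P.L - 1 - a) (μ0, true))) = g
  rw [holAt_cons, h3, mul_one]
  simp [hU]

end Walks

/-! ## §2  Coarse bonds whose (0.4) loops never visit the far end of the twisted bond: `Ū = 1` there -/
section Avoid

variable {P : Params} {j : ℕ} {G : Type*} [GaugeGroup G]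

/-- Prefix ends of a straight run of `−e_μ` letters, coordinatewise. [folklore] -/
theorem walkEnd_take_replicate_false_apply (x : Site P j) (μ : Fin P.d) (t k : ℕ) (ν : Fin P.d) :
    walkEnd x ((List.replicate t (μ, false)).take k) ν = x ν - (if μ = ν then ((min k t : ℕ) : ZMod (P.sitesPerDir j)) else 0) := by
  rw [walkEnd_apply, List.take_replicate, T4ReflectionCone.netDisp_replicate]
  generalize min k t = m
  by_cases h : μ = ν
  · simp [h, sub_eq_add_neg]
  · simp [h]

/-- **POSITIONS OF THE (0.4) LOOP** `Γ ∪ [x,x′] ∪ (−Γ′) ∪ (−c)` at `c` (index `i`): coordinate `κ` of every prefix end is `emb c₋ κ + e` with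
`−h ≤ e ≤ [c.dir = κ]·L + h`, `h = (L−1)/2` (`netDisp_take_loopWord`). [cite: Balaban1987RG1, (0.4) p.253 (bookkeeping)] -/
theorem loop_position_apply (c : PBond P (j + 1)) (i : Idx P) (k : ℕ) (κ : Fin P.d) :
    ∃ e : ℤ, -(((P.L - 1) / 2 : ℕ) : ℤ) ≤ e ∧ e ≤ (if c.dir = κ then (P.L : ℤ) else 0) + (((P.L - 1) / 2 : ℕ) : ℤ) ∧
      walkEnd (emb c.src) ((loopWord P.L c.dir (off i.1) i.2.1 i.2.2).take k) κ = emb c.src κ + ((e : ℤ) : ZMod (P.sitesPerDir j)) :=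
  ⟨_, (netDisp_take_loopWord (L := P.L) (h := (P.L - 1) / 2) c.dir (off i.1) (off_bounds i.1) i.2.1 i.2.2 k κ).1,
    (netDisp_take_loopWord (L := P.L) (h := (P.L - 1) / 2) c.dir (off i.1) (off_bounds i.1) i.2.1 i.2.2 k κ).2, walkEnd_apply _ _ _⟩

/-- **AVOIDANCE BY ONE COORDINATE ⇒ EVERY LOOP VARIABLE IS TRIVIAL.**  If along some axis `κ` no admissible loop offset `e` (`−h ≤ e ≤ [c.dir = κ]·L + h`)
puts `emb c₋ κ + e` at the `κ`-coordinate of the far end `x′ + e_{μ₀}` of the twisted bond, then every loop variable of (0.4) at `c` in the single-bond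
configuration is `1`. [cite: Balaban1987RG1, (0.4) p.253 (bookkeeping)] -/
theorem loopHol_single_eq_one_of_coord (c : PBond P (j + 1)) (x' : Site P j) (μ0 : Fin P.d) (g : G) (κ : Fin P.d)
    (hκ : ∀ e : ℤ, -(((P.L - 1) / 2 : ℕ) : ℤ) ≤ e → e ≤ (if c.dir = κ then (P.L : ℤ) else 0) + (((P.L - 1) / 2 : ℕ) : ℤ) →
      emb c.src κ + ((e : ℤ) : ZMod (P.sitesPerDir j)) ≠ (x'.shift μ0) κ) (i : Idx P) :
    loopHol (fun b : PBond P j => if b.src = x' ∧ b.dir = μ0 then g else 1) c i = 1 := by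
  unfold loopHol
  refine holAt_single_eq_one_of_ne_tgt x' μ0 g _ _ (fun k heq => ?_)
  obtain ⟨e, he1, he2, he⟩ := loop_position_apply c i k κ
  exact hκ e he1 he2 (by rw [← he, heq])

/-- The same avoidance for the straight transporter `U(c)` of (0.4): it is `1`. [cite: Balaban1984PropagatorsI, (1.7) p.18 (bookkeeping)] -/
theorem axialAvg_single_eq_one_of_coord (c : PBond P (j + 1)) (x' : Site P j) (μ0 : Fin P.d) (g : G) (κ : Fin P.d)
    (hκ : ∀ e : ℤ, -(((P.L - 1) / 2 : ℕ) : ℤ) ≤ e → e ≤ (if c.dir = κ then (P.L : ℤ) else 0) + (((P.L - 1) / 2 : ℕ) : ℤ) →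
      emb c.src κ + ((e : ℤ) : ZMod (P.sitesPerDir j)) ≠ (x'.shift μ0) κ) :
    AveragingRT.axialAvg (fun b : PBond P j => if b.src = x' ∧ b.dir = μ0 then g else 1) c = 1 := by
  rw [axialAvg_eq_holAt_walk]
  refine holAt_single_eq_one_of_ne_tgt x' μ0 g _ _ (fun k heq => ?_)
  have hc := congrFun heq κ
  rw [walkEnd_take_replicate_apply] at hc
  have hm : min k P.L ≤ P.L := Nat.min_le_right _ _
  generalize min k P.L = m at hc hm
  by_cases hdir : c.dir = κ
  · rw [if_pos hdir] at hc
    refine hκ m (by omega) (by rw [if_pos hdir]; omega) ?_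
    rw [← hc]; push_cast; rfl
  · rw [if_neg hdir] at hc
    refine hκ 0 (by omega) (by rw [if_neg hdir]; positivity) ?_
    rw [← hc]; push_cast; rfl

/-- **`Ū(c) = 1` BY AVOIDANCE**, for every small-loop average with `E(1,…,1) = 1` (the printed `exp[mean log]`: `expMeanLogSU_E_one`): all loop variables
and the straight transporter at `c` are trivial, so (0.4) returns `1`. [cite: Balaban1987RG1, (0.4) p.253 (bookkeeping)] -/
theorem avgFun_single_eq_one_of_coord (ℰ : LoopAverage G) (hE : ∀ n : ℕ, ℰ.E (fun _ : Fin (n + 1) => (1 : G)) = 1) (c : PBond P (j + 1))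
    (x' : Site P j) (μ0 : Fin P.d) (g : G) (κ : Fin P.d)
    (hκ : ∀ e : ℤ, -(((P.L - 1) / 2 : ℕ) : ℤ) ≤ e → e ≤ (if c.dir = κ then (P.L : ℤ) else 0) + (((P.L - 1) / 2 : ℕ) : ℤ) →
      emb c.src κ + ((e : ℤ) : ZMod (P.sitesPerDir j)) ≠ (x'.shift μ0) κ) :
    avgFun ℰ (fun b : PBond P j => if b.src = x' ∧ b.dir = μ0 then g else 1) c = 1 := by
  set U : GaugeField P j G := fun b => if b.src = x' ∧ b.dir = μ0 then g else 1 with hU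
  have hl : loopHol U c = fun _ => 1 := funext (loopHol_single_eq_one_of_coord c x' μ0 g κ hκ)
  have hsmall : Small ℰ U c := fun i => by rw [congrFun hl i, GaugeGroup.dist1_one]; exact ℰ.δ_pos
  show corr ℰ U c * AveragingRT.axialAvg U c = 1
  rw [axialAvg_single_eq_one_of_coord c x' μ0 g κ hκ, corr, if_pos hsmall, hl, mul_one]
  exact hE _

/-- **`Ū(c) = 1` BY LOCALITY**: if the twisted bond issues from neither block `B(c₋)` nor `B(c₊)`, the single-bond configuration agrees with `1` on the stencil of
`c` (`Averaging.local_dep`), so `Ū(c) = 1̄(c) = 1`. [cite: Balaban1985Averaging, p.19 (locality); Balaban1987RG1, (0.4) p.253 (bookkeeping)] -/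
theorem avgFun_single_eq_one_of_blockOf_ne (ℰ : LoopAverage G) (hE : ∀ n : ℕ, ℰ.E (fun _ : Fin (n + 1) => (1 : G)) = 1) (hj : j + 1 ≤ P.m + P.K)
    (c : PBond P (j + 1)) (x' : Site P j) (μ0 : Fin P.d) (g : G) (hs : blockOf x' ≠ c.src) (ht : blockOf x' ≠ c.tgt) :
    avgFun ℰ (fun b : PBond P j => if b.src = x' ∧ b.dir = μ0 then g else 1) c = 1 := by
  rw [avgFun_local ℰ hj _ (1 : GaugeField P j G) c, avgFun_one ℰ hE]
  · rfl
  · intro b hb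
    show (if b.src = x' ∧ b.dir = μ0 then g else 1) = (1 : GaugeField P j G) b
    rw [if_neg]
    · rfl
    · rintro ⟨h1, -⟩
      rw [h1] at hb
      rcases hb with h | h
      · exact hs h
      · exact ht h

end Avoid

end Summit.QuantumFields.YangMills.Theorems.K0AveragedSingleBondFloor

end
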